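import Summits.QuantumFields.GaugeBoot.LatticeWords
import Literature.MathematicalPhysics.QuantumFieldTheory.LatticeGaugeProofs
import Literature.MathematicalPhysics.QuantumFieldTheory.ConstructiveQFTWave0Proofs
import Literature.RepresentationTheory.CompactGroups.UnitaryTrick
import HarnessLib

/-!
# Gauge-boot: the loop variable of a lattice word and Gram (Hermitian) positivity

Cell `pub-gaugeboot` (HOME `run/shared/lean/pub/pub-gaugeboot/`), seat lean1; builds on the word layer
`LatticeWords` (seat lean2).

HONEST FRAMING (page 1 of every file of this cell): certified bounds on lattice expectations at
STATED coupling, gauge group, dimension and torus size; NOT a mass gap, NOT a continuum limit,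
NOT a string tension, NOT large `N`. The venture is explicitly NOT Yang–Mills-summit-bearing
(barriers `FixedCouplingUltralocality`, `PerturbativeInvisibility`).

## Content (any compact `G`, continuous matrix representation `ρ`, any torus `(ℤ/L)^d`, ANY real `β`)

* `wordLoop ρ x w U = (1/N) Re tr ρ(hol_x(w)(U))` — the loop variable of a word `w` read from `x`
  (tree `wordHolonomy`); the SDP variables of a lattice-bootstrap certificate are torus expectations
  `⟨wordLoop⟩_β` of closed words (KZ2024 §2, GLYZ2025 §2). Pointwise facts: empty word ↦ `1` (`N ≥ 1`),
  backtrack insensitivity, reversal and cyclic rotation of CLOSED words, `|·| ≤ 1`, measurability for the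
  product σ-algebra (no countability on `G`), integrability.
* **Gram (Hermitian) positivity, Class-A "H" block** (RP-INSTANCES.md §A; KZ2022 "positivity of the
  inner product of Wilson lines"): for closed words `O₁ … Oₙ` at a common base point `x` and real
  coefficients `c`, `0 ≤ ∑ᵢⱼ cᵢ cⱼ ⟨W_x(Oᵢ⁻¹ · Oⱼ)⟩_β` (`sum_mul_wilsonExpectation_wordLoop_nonneg`).
  Proof: pointwise `∑ᵢⱼ cᵢcⱼ (1/N) Re tr ρ(hᵢ⁻¹hⱼ) = (1/N) Re tr (Mᴴ M) ≥ 0` with `M = ∑ⱼ cⱼ σ(hⱼ)` for the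
  unitarised representation `σ` (tree `CompactGroup.unitarize`), then integrate. It holds for EVERY
  probability measure, in particular for every `β` and every `L`; no reflection is involved.

Not here: the lattice-symmetry transport of `⟨wordLoop⟩` (file `WordSymmetry`), reflection-positivity
blocks (tree theorems `wilsonExpectation_siteReflectionPositive`, `wilsonExpectation_gram_link_nonneg`),
loop equations (task L1), certificates.
-/

noncomputable section

open MeasureTheory
open scoped ComplexOrder Matrix
open Literature.MathematicalPhysics.QuantumFieldTheory
open Literature.RepresentationTheory.CompactGroups

namespace Summit.QuantumFields.GaugeBoot

section LoopVariable

variable {d L N : ℕ} {G : Type*} [Group G] [TopologicalSpace G] [IsTopologicalGroup G]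
  [CompactSpace G] [MeasurableSpace G] [BorelSpace G] (ρ : G →* Matrix (Fin N) (Fin N) ℂ)

/-- The loop variable `W_x(w)(U) = (1/N) Re tr ρ(hol_x(w)(U))` of the word `w` read from `x`
(KZ2024 / GLYZ2025: the SDP variables are the expectations of these for closed words; junk `0` for
`N = 0`). [folklore] -/
def wordLoop (x : Site d L) (w : Word d) (U : GaugeConfig d L G) : ℝ :=
  (N : ℝ)⁻¹ * (ρ (wordHolonomy U x w)).trace.re

omit [TopologicalSpace G] [IsTopologicalGroup G] [CompactSpace G] [MeasurableSpace G] [BorelSpace G] in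
/-- Unfolding lemma. [folklore] -/
theorem wordLoop_apply (x : Site d L) (w : Word d) (U : GaugeConfig d L G) :
    wordLoop ρ x w U = (N : ℝ)⁻¹ * (ρ (wordHolonomy U x w)).trace.re := rfl

omit [TopologicalSpace G] [IsTopologicalGroup G] [CompactSpace G] [MeasurableSpace G] [BorelSpace G] in
/-- The empty word has loop variable `1` (`N ≥ 1`). [folklore] -/
theorem wordLoop_nil (hN : N ≠ 0) (x : Site d L) :
    wordLoop ρ x ([] : Word d) = fun _ : GaugeConfig d L G => 1 := by
  funext U
  have hN' : (N : ℝ) ≠ 0 := by exact_mod_cast hN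
  simp [wordLoop, Matrix.trace_one, hN']

omit [TopologicalSpace G] [IsTopologicalGroup G] [CompactSpace G] [MeasurableSpace G] [BorelSpace G] in
/-- A backtrack `s s⁻¹` inside a word does not change the loop variable. [folklore] -/
theorem wordLoop_backtrack (x : Site d L) (v w : Word d) (s : Step d) :
    wordLoop ρ x (v ++ [s, s.inv] ++ w) = wordLoop (G := G) ρ x (v ++ w) := by
  funext U
  simp only [wordLoop, wordHolonomy_backtrack]

omit [MeasurableSpace G] [BorelSpace G] in
/-- Reversal of a CLOSED word does not change the loop variable (`Re tr ρ(h⁻¹) = Re tr ρ(h)` for a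
continuous representation of a compact group). [folklore] -/
theorem wordLoop_reverse (hρ : Continuous ρ) (x : Site d L) (w : Word d) (hw : Word.endpoint x w = x) :
    wordLoop ρ x (Word.reverse w) = wordLoop (G := G) ρ x w := by
  funext U
  have h := wordHolonomy_reverse U x w
  rw [hw] at h
  simp only [wordLoop, h, CompactGroup.re_trace_map_inv ρ hρ]

omit [TopologicalSpace G] [IsTopologicalGroup G] [CompactSpace G] [MeasurableSpace G] [BorelSpace G] in
/-- Cyclic rotation of a CLOSED word (first step moved to the end, base point moved along) does not
change the loop variable (cyclicity of the trace). [folklore] -/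
theorem wordLoop_rotate (x : Site d L) (s : Step d) (w : Word d) (hw : Word.endpoint x (s :: w) = x) :
    wordLoop ρ x (s :: w) = wordLoop (G := G) ρ (s.apply x) (w ++ [s]) := by
  funext U
  have hend : Word.endpoint (s.apply x) w = x := by simpa using hw
  simp only [wordLoop, wordHolonomy_cons, wordHolonomy_append, hend, wordHolonomy_nil, mul_one, map_mul]
  rw [Matrix.trace_mul_comm]

omit [MeasurableSpace G] [BorelSpace G] in
/-- `|W_x(w)| ≤ 1` (`|Re tr ρ(g)| ≤ N`, tree `CompactGroup.abs_re_trace_le_card`). [folklore] -/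
theorem abs_wordLoop_le_one (hρ : Continuous ρ) (x : Site d L) (w : Word d) (U : GaugeConfig d L G) :
    |wordLoop ρ x w U| ≤ 1 := by
  unfold wordLoop
  have h := CompactGroup.abs_re_trace_le_card ρ hρ (wordHolonomy U x w)
  rw [Fintype.card_fin] at h
  rcases Nat.eq_zero_or_pos N with hN | hN
  · subst hN; simp
  · rw [abs_mul, abs_inv, Nat.abs_cast]
    calc (N : ℝ)⁻¹ * |(ρ (wordHolonomy U x w)).trace.re| ≤ (N : ℝ)⁻¹ * N := by gcongr
      _ = 1 := inv_mul_cancel₀ (by exact_mod_cast hN.ne')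

omit [CompactSpace G] in
/-- Word holonomies are entry-measurable for the product σ-algebra (no countability assumption on
`G`; tree `WilsonRP.EntryMeasurable`). [folklore] -/
theorem entryMeasurable_wordHolonomy (hρ : Continuous ρ) :
    ∀ (w : Word d) (x : Site d L),
      WilsonRP.EntryMeasurable ρ fun U : GaugeConfig d L G => wordHolonomy U x w
  | [], x => fun k l => by simp only [wordHolonomy_nil, map_one]; exact measurable_const
  | s :: w, x => by
    have hs : WilsonRP.EntryMeasurable ρ fun U : GaugeConfig d L G => stepHolonomy U x s := by
      cases s with
      | fwd μ => simpa using WilsonRP.entryMeasurable_apply hρ (x, μ)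
      | bwd μ => simpa using WilsonRP.entryMeasurable_apply_inv hρ (x - Pi.single μ 1, μ)
    simpa using hs.mul (entryMeasurable_wordHolonomy hρ w (s.apply x))

omit [CompactSpace G] in
/-- `W_x(w)` is measurable. [folklore] -/
theorem measurable_wordLoop (hρ : Continuous ρ) (x : Site d L) (w : Word d) :
    Measurable (wordLoop (d := d) (L := L) (G := G) ρ x w) :=
  (entryMeasurable_wordHolonomy ρ hρ w x).measurable_trace_re.const_mul _

/-- `W_x(w)` is integrable for the torus Wilson measure (any real `β`). [folklore] -/
theorem integrable_wordLoop [NeZero L] (hρ : Continuous ρ) (β : ℝ) (x : Site d L) (w : Word d) :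
    Integrable (wordLoop ρ x w) (wilsonMeasure (d := d) (L := L) (G := G) ρ β) := by
  haveI := isProbabilityMeasure_wilsonMeasure (d := d) (L := L) (G := G) ρ hρ β
  exact Integrable.of_bound (measurable_wordLoop ρ hρ x w).aestronglyMeasurable 1
    (ae_of_all _ fun U => by rw [Real.norm_eq_abs]; exact abs_wordLoop_le_one ρ hρ x w U)

/-- The torus expectation `⟨W_x(w)⟩_β` lies in `[-1, 1]`. [folklore] -/
theorem abs_wilsonExpectation_wordLoop_le_one [NeZero L] (hρ : Continuous ρ) (β : ℝ) (x : Site d L)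
    (w : Word d) : |wilsonExpectation ρ β (wordLoop (G := G) ρ x w)| ≤ 1 := by
  haveI := isProbabilityMeasure_wilsonMeasure (d := d) (L := L) (G := G) ρ hρ β
  unfold wilsonExpectation
  calc |∫ U, wordLoop ρ x w U ∂(wilsonMeasure ρ β)| ≤ ∫ U, |wordLoop ρ x w U| ∂(wilsonMeasure ρ β) :=
        abs_integral_le_integral_abs
    _ ≤ ∫ _U, (1 : ℝ) ∂(wilsonMeasure (d := d) (L := L) (G := G) ρ β) :=
        integral_mono (integrable_wordLoop ρ hρ β x w).abs (integrable_const _)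
          fun U => abs_wordLoop_le_one ρ hρ x w U
    _ = 1 := by simp

end LoopVariable

/-! ## Gram (Hermitian) positivity of based loops -/

section Gram

variable {d L N : ℕ} {G : Type*} [Group G] [TopologicalSpace G] [IsTopologicalGroup G]
  [CompactSpace G] [MeasurableSpace G] [BorelSpace G] (ρ : G →* Matrix (Fin N) (Fin N) ℂ)

omit [MeasurableSpace G] [BorelSpace G] in
/-- **Pointwise Gram identity / positivity**: for closed words `Oᵢ` at `x` and real `cᵢ`,
`∑ᵢⱼ cᵢ cⱼ W_x(Oᵢ⁻¹ · Oⱼ)(U) = (1/N) Re tr (Mᴴ M) ≥ 0`, `M = ∑ⱼ cⱼ σ(hol_x(Oⱼ)(U))` with `σ` the unitarised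
representation. [folklore] -/
theorem sum_mul_wordLoop_nonneg (hρ : Continuous ρ) (x : Site d L) {n : ℕ} (O : Fin n → Word d)
    (hO : ∀ i, Word.endpoint x (O i) = x) (c : Fin n → ℝ) (U : GaugeConfig d L G) :
    0 ≤ ∑ i, ∑ j, c i * c j * wordLoop ρ x (Word.reverse (O i) ++ O j) U := by
  set σ := CompactGroup.unitarize ρ hρ with hσ
  set h : Fin n → G := fun i => wordHolonomy U x (O i) with hh
  have hhol : ∀ i j, wordHolonomy U x (Word.reverse (O i) ++ O j) = (h i)⁻¹ * h j := by
    intro i j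
    rw [wordHolonomy_append]
    have h1 := wordHolonomy_reverse U x (O i)
    have h2 := Word.endpoint_reverse x (O i)
    rw [hO i] at h1 h2
    rw [h1, h2]
  have htr : ∀ i j, (ρ ((h i)⁻¹ * h j)).trace = ((σ (h i))ᴴ * σ (h j)).trace := by
    intro i j
    rw [← CompactGroup.trace_unitarize ρ hρ, map_mul, CompactGroup.unitarize_inv,
      Matrix.star_eq_conjTranspose]
  set M : Matrix (Fin N) (Fin N) ℂ := ∑ j, (c j : ℂ) • σ (h j) with hM
  have hMsum : (Mᴴ * M).trace = ∑ i, ∑ j, (c i : ℂ) * (c j : ℂ) * ((σ (h j))ᴴ * σ (h i)).trace := by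
    simp only [hM, Matrix.conjTranspose_sum, Matrix.conjTranspose_smul, Complex.star_def,
      Complex.conj_ofReal, Finset.sum_mul, Finset.mul_sum, Matrix.smul_mul, Matrix.mul_smul,
      Matrix.trace_sum, Matrix.trace_smul, smul_eq_mul]
    exact Finset.sum_congr rfl fun i _ => Finset.sum_congr rfl fun j _ => by ring
  have hpsd : 0 ≤ ((Mᴴ * M).trace).re := by
    have h0 : (0 : ℂ) ≤ (Mᴴ * M).trace := (Matrix.posSemidef_conjTranspose_mul_self M).trace_nonneg
    exact (Complex.nonneg_iff.mp h0).1
  have hre : ((Mᴴ * M).trace).re = ∑ i, ∑ j, c i * c j * ((σ (h j))ᴴ * σ (h i)).trace.re := by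
    rw [hMsum, Complex.re_sum]
    refine Finset.sum_congr rfl fun i _ => ?_
    rw [Complex.re_sum]
    refine Finset.sum_congr rfl fun j _ => ?_
    rw [← Complex.ofReal_mul, Complex.re_ofReal_mul]
  have hexpr : ∑ i, ∑ j, c i * c j * wordLoop ρ x (Word.reverse (O i) ++ O j) U =
      (N : ℝ)⁻¹ * ((Mᴴ * M).trace).re := by
    rw [hre, Finset.sum_comm, Finset.mul_sum]
    refine Finset.sum_congr rfl fun i _ => ?_
    rw [Finset.mul_sum]
    refine Finset.sum_congr rfl fun j _ => ?_
    rw [wordLoop_apply, hhol, htr]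
    ring
  rw [hexpr]
  exact mul_nonneg (inv_nonneg.2 (Nat.cast_nonneg N)) hpsd

/-- **Gram (Hermitian) positivity of the torus Wilson state — the Class-A "H" block.** For every
compact `G`, continuous `ρ`, torus `(ℤ/L)^d`, real `β`, base point `x`, closed words `O₁, …, Oₙ` at `x`
and real coefficients `c`: `0 ≤ ∑ᵢ ∑ⱼ cᵢ cⱼ ⟨W_x(Oᵢ⁻¹ · Oⱼ)⟩_β`, i.e. the matrix
`(⟨W_x(Oᵢ⁻¹ · Oⱼ)⟩_β)ᵢⱼ` is positive semidefinite (KZ2022 / KZ2024 / GLYZ2025: "Hermitian positivity";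
valid for every probability measure on configurations — no reflection positivity involved). [folklore] -/
theorem sum_mul_wilsonExpectation_wordLoop_nonneg [NeZero L] (hρ : Continuous ρ) (β : ℝ) (x : Site d L)
    {n : ℕ} (O : Fin n → Word d) (hO : ∀ i, Word.endpoint x (O i) = x) (c : Fin n → ℝ) :
    0 ≤ ∑ i, ∑ j, c i * c j * wilsonExpectation ρ β (wordLoop (G := G) ρ x (Word.reverse (O i) ++ O j)) := by
  have hint : ∀ i j, Integrable (fun U => c i * c j * wordLoop ρ x (Word.reverse (O i) ++ O j) U)
      (wilsonMeasure (d := d) (L := L) (G := G) ρ β) := fun i j =>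
    (integrable_wordLoop ρ hρ β x _).const_mul _
  have hswap : ∑ i, ∑ j, c i * c j * wilsonExpectation ρ β (wordLoop (G := G) ρ x (Word.reverse (O i) ++ O j))
      = wilsonExpectation ρ β fun U => ∑ i, ∑ j, c i * c j * wordLoop (G := G) ρ x (Word.reverse (O i) ++ O j) U := by
    unfold wilsonExpectation
    rw [integral_finsetSum _ fun i _ => integrable_finsetSum _ fun j _ => hint i j]
    refine Finset.sum_congr rfl fun i _ => ?_
    rw [integral_finsetSum _ fun j _ => hint i j]
    refine Finset.sum_congr rfl fun j _ => ?_
    rw [integral_const_mul]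
  rw [hswap]
  exact integral_nonneg fun U => sum_mul_wordLoop_nonneg ρ hρ x O hO c U

end Gram

end Summit.QuantumFields.GaugeBoot

end
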